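import Mathlib.Combinatorics.SetFamily.HarrisKleitman
import Mathlib.Tactic.Linarith
import Mathlib.Tactic.Positivity
import Mathlib.Tactic.Ring
import HarnessLib

/-!
# `NoHeavyLowerTail` (crux stmt-CriticalPhenomena-4575), P3 lane: the KLEITMAN SURPLUS of the traces of two up-sets on a sub-cube —
# pair formula, vertex recursion, nonnegativity and the LOOP lemma (memo g25 §2)

Support file (seat `prim-l12-p3`, gen 25; `--supports stmt-CriticalPhenomena-4575`).  Memo `run/shared/lean/prim/prim-l12/FROM-prim-l12-p3-g25-
LADDER-L2-PROOF.md` §2.  A SUB-CUBE of `2^α` is given by a base `D` and a free finset `s`; the TRACE of a family `𝒳` on it is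
`tr 𝒳 D s = {U ⊆ s : D ∪ U ∈ 𝒳}`, and the KLEITMAN SURPLUS of two families there is
    `kap 𝒳 𝒵 D s := #(tr 𝒳 ∩ tr 𝒵) − #{U ∈ tr 𝒳 : s \ U ∈ tr 𝒵}`
— the coefficient of the Harris form `Π·GF(𝒳∩𝒵) − GF(𝒳)GF(𝒵)` at the profile `2·1_D + 1_s` (file `…SahiCTCHarrisCoeff`).  This file (pure finite
combinatorics, no polynomials): `mem_tr`, `tr_inter`, up-closure of traces; `kap_eq_pairs` (PAIR FORMULA
`κ = #{U ∈ A∩B : s\U ∉ A∪B} − #{U ∈ A\B : s\U ∈ B\A}`); `kap_rec` (VERTEX RECURSION at `v ∈ s`: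
`κ(D,s) = κ(D,s−v) + κ(D+v,s−v) + #{R ∈ tr(D+v)\tr(D) : (s−v)\R ∈ tr'(D+v)\tr'(D)}`); `kap_nonneg`, `kap_erase_le` (deleting a free point does not
increase κ); `one_le_kap_of_loop` (LOOP: if `D ∉ 𝒳 ∪ 𝒵` and `D+u ∈ 𝒳 ∩ 𝒵` for some free `u` then `κ ≥ 1`, indeed `κ = #{U ∈ A∩B : s\U ∉ A∪B}`).
The triangle / degree / density lemmas are in `…SahiCTCKleitmanDensity`.  Nothing is asserted about the crux.
-/

namespace Summit.CriticalPhenomena.PercolationContinuityZ3.Theorems.SahiCTCForms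

open Finset

variable {α : Type*} [DecidableEq α]

/-! ### Traces and the surplus -/

/-- The trace of `𝒳` on the sub-cube with base `D` and free set `s`: `{U ⊆ s : D ∪ U ∈ 𝒳}`. [this work] -/
def tr (𝒳 : Finset (Finset α)) (D s : Finset α) : Finset (Finset α) := s.powerset.filter fun U => D ∪ U ∈ 𝒳

/-- The Kleitman surplus of `𝒳, 𝒵` on the sub-cube `(D, s)`: `#(tr 𝒳 ∩ tr 𝒵) − #{U ∈ tr 𝒳 : s \ U ∈ tr 𝒵}`. [this work] -/
def kap (𝒳 𝒵 : Finset (Finset α)) (D s : Finset α) : ℤ :=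
  (#(tr 𝒳 D s ∩ tr 𝒵 D s) : ℤ) - #((tr 𝒳 D s).filter fun U => s \ U ∈ tr 𝒵 D s)

section Basic
variable {𝒳 𝒵 : Finset (Finset α)} {D s : Finset α}

/-- Membership in a trace. [this work] -/
theorem mem_tr {U : Finset α} : U ∈ tr 𝒳 D s ↔ U ⊆ s ∧ D ∪ U ∈ 𝒳 := by
  unfold tr; rw [mem_filter, mem_powerset]

/-- Members of a trace are subsets of the free set. [this work] -/
theorem subset_of_mem_tr {U : Finset α} (h : U ∈ tr 𝒳 D s) : U ⊆ s := (mem_tr.1 h).1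

/-- The trace of an intersection is the intersection of the traces. [this work] -/
theorem tr_inter : tr (𝒳 ∩ 𝒵) D s = tr 𝒳 D s ∩ tr 𝒵 D s := by
  ext U; simp only [mem_tr, mem_inter]; tauto

/-- Traces of an up-set are up-closed inside `s`. [this work] -/
theorem mem_tr_of_subset (h𝒳 : IsUpperSet (𝒳 : Set (Finset α))) {U U' : Finset α} (hU : U ∈ tr 𝒳 D s) (hUU' : U ⊆ U')
    (hU' : U' ⊆ s) : U' ∈ tr 𝒳 D s :=
  mem_tr.2 ⟨hU', h𝒳 (union_subset_union Subset.rfl hUU') (mem_tr.1 hU).2⟩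

/-- A nonempty trace of an up-set contains the top `s`. [this work] -/
theorem top_mem_tr (h𝒳 : IsUpperSet (𝒳 : Set (Finset α))) {U : Finset α} (hU : U ∈ tr 𝒳 D s) : s ∈ tr 𝒳 D s :=
  mem_tr_of_subset h𝒳 hU (subset_of_mem_tr hU) Subset.rfl

/-- `∅` is in the trace iff the base is a member. [this work] -/
theorem empty_mem_tr_iff : (∅ : Finset α) ∈ tr 𝒳 D s ↔ D ∈ 𝒳 := by
  rw [mem_tr, union_empty]; exact ⟨fun h => h.2, fun h => ⟨empty_subset _, h⟩⟩

/-- With empty base the trace is the restriction `𝒳 ∩ 2^s`. [this work] -/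
theorem mem_tr_empty {U : Finset α} : U ∈ tr 𝒳 ∅ s ↔ U ⊆ s ∧ U ∈ 𝒳 := by
  rw [mem_tr, empty_union]

/-- Double complement inside the free set. [this work] -/
theorem sdiff_sdiff_self_of_mem_tr {U : Finset α} (hU : U ∈ tr 𝒳 D s) : s \ (s \ U) = U :=
  Finset.sdiff_sdiff_eq_self (subset_of_mem_tr hU)

end Basic

/-! ### The pair formula -/

section Pair
variable {𝒳 𝒵 : Finset (Finset α)} {D s : Finset α}

/-- **Pair formula**: grouping `U` with `s \ U`,
`κ = #{U ∈ A ∩ B : s\U ∉ A ∧ s\U ∉ B} − #{U ∈ A \ B : s\U ∈ B ∧ s\U ∉ A}` (`A, B` the two traces). [this work] -/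
theorem kap_eq_pairs :
    kap 𝒳 𝒵 D s = (#((tr 𝒳 D s ∩ tr 𝒵 D s).filter fun U => s \ U ∉ tr 𝒳 D s ∧ s \ U ∉ tr 𝒵 D s) : ℤ)
      - #((tr 𝒳 D s \ tr 𝒵 D s).filter fun U => s \ U ∈ tr 𝒵 D s ∧ s \ U ∉ tr 𝒳 D s) := by
  set A := tr 𝒳 D s with hAdef
  set B := tr 𝒵 D s with hBdef
  have hA : ∀ U ∈ A, U ⊆ s := fun U hU => subset_of_mem_tr hU
  unfold kap
  rw [← hAdef, ← hBdef]
  have h1 : #(A ∩ B) = #((A ∩ B).filter fun U => s \ U ∉ A ∧ s \ U ∉ B) +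
      #((A ∩ B).filter fun U => ¬ (s \ U ∉ A ∧ s \ U ∉ B)) :=
      (card_filter_add_card_filter_not (s := A ∩ B) (fun U => s \ U ∉ A ∧ s \ U ∉ B)).symm
  have h2 : #((A ∩ B).filter fun U => ¬ (s \ U ∉ A ∧ s \ U ∉ B)) =
      #((A ∩ B).filter fun U => s \ U ∈ B) + #((A ∩ B).filter fun U => s \ U ∈ A ∧ s \ U ∉ B) := by
    rw [← card_union_of_disjoint (disjoint_filter.2 fun U _ h1 h2 => h2.2 h1)]
    congr 1; ext U; simp only [mem_filter, mem_union, not_and_or, not_not]; tauto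
  have h3 : #(A.filter fun U => s \ U ∈ B) =
      #((A ∩ B).filter fun U => s \ U ∈ B) + #((A \ B).filter fun U => s \ U ∈ B) := by
    rw [← card_union_of_disjoint (disjoint_filter_filter (disjoint_sdiff_inter A B).symm)]
    congr 1; ext U; simp only [mem_filter, mem_union, mem_inter, mem_sdiff]; tauto
  have h4 : #((A \ B).filter fun U => s \ U ∈ B) =
      #((A \ B).filter fun U => s \ U ∈ B ∧ s \ U ∉ A) + #((A \ B).filter fun U => s \ U ∈ B ∧ s \ U ∈ A) := by
    rw [← card_union_of_disjoint (disjoint_filter.2 fun U _ h1 h2 => h1.2 h2.2)]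
    congr 1; ext U; simp only [mem_filter, mem_union]; tauto
  have h5 : #((A ∩ B).filter fun U => s \ U ∈ A ∧ s \ U ∉ B) = #((A \ B).filter fun U => s \ U ∈ B ∧ s \ U ∈ A) := by
    refine card_bij (fun U _ => s \ U) (fun U hU => ?_) (fun U hU U' hU' h => ?_) (fun U hU => ?_)
    · obtain ⟨hUAB, hA', hB'⟩ := mem_filter.1 hU
      have hUs : U ⊆ s := hA U (mem_inter.1 hUAB).1
      refine mem_filter.2 ⟨mem_sdiff.2 ⟨hA', hB'⟩, ?_⟩
      rw [Finset.sdiff_sdiff_eq_self hUs]; exact ⟨(mem_inter.1 hUAB).2, (mem_inter.1 hUAB).1⟩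
    · have hUs : U ⊆ s := hA U (mem_inter.1 (mem_filter.1 hU).1).1
      have hU's : U' ⊆ s := hA U' (mem_inter.1 (mem_filter.1 hU').1).1
      rw [← Finset.sdiff_sdiff_eq_self hUs, h, Finset.sdiff_sdiff_eq_self hU's]
    · obtain ⟨hUAB, hB', hA'⟩ := mem_filter.1 hU
      have hUs : U ⊆ s := hA U (mem_sdiff.1 hUAB).1
      refine ⟨s \ U, mem_filter.2 ⟨mem_inter.2 ⟨hA', hB'⟩, ?_⟩, Finset.sdiff_sdiff_eq_self hUs⟩
      rw [Finset.sdiff_sdiff_eq_self hUs]; exact ⟨(mem_sdiff.1 hUAB).1, (mem_sdiff.1 hUAB).2⟩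
  rw [h1, h2, h3, h4, h5]; push_cast; ring

/-- **LOOP lemma**: if the base `D` lies in neither up-set but `D + u` lies in both for some free `u ∈ s` (a common loop of the traces), then no
'negative pair' exists and `κ = #{U ∈ A ∩ B : s\U ∉ A ∪ B} ≥ 1` (the pair `(s, ∅)`). [this work] -/
theorem one_le_kap_of_loop (h𝒳 : IsUpperSet (𝒳 : Set (Finset α))) (h𝒵 : IsUpperSet (𝒵 : Set (Finset α)))
    (hD𝒳 : D ∉ 𝒳) (hD𝒵 : D ∉ 𝒵) {u : α} (hu : u ∈ s) (hu𝒳 : insert u D ∈ 𝒳) (hu𝒵 : insert u D ∈ 𝒵) :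
    1 ≤ kap 𝒳 𝒵 D s := by
  rw [kap_eq_pairs]
  -- no negative pairs
  have hneg : ((tr 𝒳 D s \ tr 𝒵 D s).filter fun U => s \ U ∈ tr 𝒵 D s ∧ s \ U ∉ tr 𝒳 D s) = ∅ := by
    refine filter_eq_empty_iff.2 fun U hU h => ?_
    obtain ⟨hUX, hUZ⟩ := mem_sdiff.1 hU
    have hUs := subset_of_mem_tr hUX
    by_cases huU : u ∈ U
    · -- u ∈ U ⇒ D ∪ U ⊇ D + u ∈ 𝒵
      exact hUZ (mem_tr.2 ⟨hUs, h𝒵 (by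
        intro x hx; rcases mem_insert.1 hx with rfl | hx
        · exact mem_union_right _ huU
        · exact mem_union_left _ hx) hu𝒵⟩)
    · -- u ∈ s \ U ⇒ D ∪ (s \ U) ⊇ D + u ∈ 𝒳
      exact h.2 (mem_tr.2 ⟨sdiff_subset, h𝒳 (by
        intro x hx; rcases mem_insert.1 hx with rfl | hx
        · exact mem_union_right _ (mem_sdiff.2 ⟨hu, huU⟩)
        · exact mem_union_left _ hx) hu𝒳⟩)
  rw [hneg, card_empty, Nat.cast_zero, sub_zero]
  -- the positive pair (s, ∅)
  have hsX : s ∈ tr 𝒳 D s := mem_tr.2 ⟨Subset.rfl, h𝒳 (by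
    intro x hx; rcases mem_insert.1 hx with rfl | hx
    · exact mem_union_right _ hu
    · exact mem_union_left _ hx) hu𝒳⟩
  have hsZ : s ∈ tr 𝒵 D s := mem_tr.2 ⟨Subset.rfl, h𝒵 (by
    intro x hx; rcases mem_insert.1 hx with rfl | hx
    · exact mem_union_right _ hu
    · exact mem_union_left _ hx) hu𝒵⟩
  have hmem : s ∈ (tr 𝒳 D s ∩ tr 𝒵 D s).filter fun U => s \ U ∉ tr 𝒳 D s ∧ s \ U ∉ tr 𝒵 D s := by
    refine mem_filter.2 ⟨mem_inter.2 ⟨hsX, hsZ⟩, ?_, ?_⟩ <;> rw [Finset.sdiff_self, empty_mem_tr_iff]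
    · exact hD𝒳
    · exact hD𝒵
  exact_mod_cast card_pos.2 ⟨s, hmem⟩

end Pair

/-! ### The vertex recursion -/

section Rec
variable {𝒳 𝒵 : Finset (Finset α)} {D s : Finset α} {v : α}

/-- `(D + v) ∪ R = D ∪ (R + v)`. [this work] -/
theorem insert_union_eq (v : α) (D R : Finset α) : insert v D ∪ R = D ∪ insert v R := by
  ext x; simp only [mem_union, mem_insert]; tauto

/-- Members of the trace on `(D, s)` containing `v` ↔ members of the trace on `(D+v, s−v)` (by erasing `v`). [this work] -/
theorem mem_tr_insert_iff (hv : v ∈ s) {R : Finset α} :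
    R ∈ tr 𝒳 (insert v D) (s.erase v) ↔ v ∉ R ∧ insert v R ∈ tr 𝒳 D s := by
  rw [mem_tr, mem_tr, insert_union_eq]
  constructor
  · rintro ⟨hRs, hR⟩
    exact ⟨fun h => by simpa using hRs h, insert_subset hv (hRs.trans (erase_subset v s)), hR⟩
  · rintro ⟨hvR, hRs, hR⟩
    refine ⟨fun x hx => mem_erase.2 ⟨fun h => hvR (h ▸ hx), hRs (mem_insert_of_mem hx)⟩, hR⟩

/-- Members of the trace on `(D, s)` avoiding `v` = members of the trace on `(D, s−v)`. [this work] -/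
theorem mem_tr_erase_iff {U : Finset α} : U ∈ tr 𝒳 D (s.erase v) ↔ v ∉ U ∧ U ∈ tr 𝒳 D s := by
  rw [mem_tr, mem_tr]
  constructor
  · rintro ⟨hUs, hU⟩; exact ⟨fun h => by simpa using hUs h, hUs.trans (erase_subset v s), hU⟩
  · rintro ⟨hvU, hUs, hU⟩; exact ⟨fun x hx => mem_erase.2 ⟨fun h => hvU (h ▸ hx), hUs hx⟩, hU⟩

/-- For an up-set, the trace on `(D, s−v)` is contained in the trace on `(D+v, s−v)`. [this work] -/
theorem tr_erase_subset_tr_insert (h𝒳 : IsUpperSet (𝒳 : Set (Finset α))) :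
    tr 𝒳 D (s.erase v) ⊆ tr 𝒳 (insert v D) (s.erase v) := fun U hU => by
  obtain ⟨hUs, hU⟩ := mem_tr.1 hU
  exact mem_tr.2 ⟨hUs, h𝒳 (union_subset_union (subset_insert v D) Subset.rfl) hU⟩

/-- **Vertex recursion** at a free point `v ∈ s` (with `v ∉ D`): writing `s' = s − v`, `A⁰ = tr 𝒳 D s'` (deletion), `A¹ = tr 𝒳 (D+v) s'` (link),
`κ(D,s) = κ(D,s') + κ(D+v,s') + #{R ∈ A¹ \ A⁰ : s'\R ∈ B¹ \ B⁰}`. [this work] -/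
theorem kap_rec (h𝒳 : IsUpperSet (𝒳 : Set (Finset α))) (h𝒵 : IsUpperSet (𝒵 : Set (Finset α))) (hv : v ∈ s) (hvD : v ∉ D) :
    kap 𝒳 𝒵 D s = kap 𝒳 𝒵 D (s.erase v) + kap 𝒳 𝒵 (insert v D) (s.erase v) +
      #((tr 𝒳 (insert v D) (s.erase v) \ tr 𝒳 D (s.erase v)).filter fun R =>
        (s.erase v) \ R ∈ tr 𝒵 (insert v D) (s.erase v) ∧ (s.erase v) \ R ∉ tr 𝒵 D (s.erase v)) := by
  have hss' : ∀ U : Finset α, v ∉ U → s \ U = insert v (s.erase v \ U) := fun U hvU => by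
    ext x; simp only [mem_sdiff, mem_insert, mem_erase]
    constructor
    · rintro ⟨hxs, hxU⟩; by_cases hxv : x = v; exact Or.inl hxv; exact Or.inr ⟨⟨hxv, hxs⟩, hxU⟩
    · rintro (rfl | ⟨⟨_, hxs⟩, hxU⟩); exact ⟨hv, hvU⟩; exact ⟨hxs, hxU⟩
  have hss'' : ∀ R : Finset α, v ∉ R → s \ insert v R = s.erase v \ R := fun R hvR => by
    ext x; simp only [mem_sdiff, mem_insert, mem_erase, not_or]; tauto
  -- (1) #(A ∩ B) = #(A0 ∩ B0) + #(A1 ∩ B1)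
  have c1 : #(tr 𝒳 D s ∩ tr 𝒵 D s) = #(tr 𝒳 D (s.erase v) ∩ tr 𝒵 D (s.erase v)) +
      #(tr 𝒳 (insert v D) (s.erase v) ∩ tr 𝒵 (insert v D) (s.erase v)) := by
    rw [← card_filter_add_card_filter_not (s := tr 𝒳 D s ∩ tr 𝒵 D s) (fun U => v ∉ U)]
    congr 1
    · congr 1; ext U
      simp only [mem_filter, mem_inter, mem_tr_erase_iff]; tauto
    · refine card_bij (fun U _ => U.erase v) (fun U hU => ?_) (fun U hU U' hU' h => ?_) (fun R hR => ?_)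
      · obtain ⟨hUAB, hvU⟩ := mem_filter.1 hU
        rw [not_not] at hvU
        refine mem_inter.2 ⟨(mem_tr_insert_iff hv).2 ⟨notMem_erase v U, ?_⟩,
          (mem_tr_insert_iff hv).2 ⟨notMem_erase v U, ?_⟩⟩ <;> rw [insert_erase hvU]
        · exact (mem_inter.1 hUAB).1
        · exact (mem_inter.1 hUAB).2
      · have h1 : v ∈ U := not_not.1 (mem_filter.1 hU).2
        have h2 : v ∈ U' := not_not.1 (mem_filter.1 hU').2
        rw [← insert_erase h1, h, insert_erase h2]
      · obtain ⟨hRA, hRB⟩ := mem_inter.1 hR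
        obtain ⟨hvR, hRA'⟩ := (mem_tr_insert_iff hv).1 hRA
        obtain ⟨_, hRB'⟩ := (mem_tr_insert_iff hv).1 hRB
        exact ⟨insert v R, mem_filter.2 ⟨mem_inter.2 ⟨hRA', hRB'⟩, not_not.2 (mem_insert_self v R)⟩, erase_insert hvR⟩
  -- (2) #{U ∈ A : s\U ∈ B} = #{U ∈ A0 : s'\U ∈ B1} + #{R ∈ A1 : s'\R ∈ B0}
  have c2 : #((tr 𝒳 D s).filter fun U => s \ U ∈ tr 𝒵 D s) =
      #((tr 𝒳 D (s.erase v)).filter fun U => s.erase v \ U ∈ tr 𝒵 (insert v D) (s.erase v)) +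
      #((tr 𝒳 (insert v D) (s.erase v)).filter fun R => s.erase v \ R ∈ tr 𝒵 D (s.erase v)) := by
    rw [← card_filter_add_card_filter_not (s := (tr 𝒳 D s).filter fun U => s \ U ∈ tr 𝒵 D s) (fun U => v ∉ U)]
    congr 1
    · congr 1; ext U
      simp only [mem_filter]
      constructor
      · rintro ⟨⟨hUA, hUB⟩, hvU⟩
        refine ⟨mem_tr_erase_iff.2 ⟨hvU, hUA⟩, (mem_tr_insert_iff hv).2 ⟨by simp, ?_⟩⟩
        rwa [← hss' U hvU]
      · rintro ⟨hUA0, hUB1⟩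
        obtain ⟨hvU, hUA⟩ := mem_tr_erase_iff.1 hUA0
        obtain ⟨_, hUB⟩ := (mem_tr_insert_iff hv).1 hUB1
        exact ⟨⟨hUA, by rwa [hss' U hvU]⟩, hvU⟩
    · refine card_bij (fun U _ => U.erase v) (fun U hU => ?_) (fun U hU U' hU' h => ?_) (fun R hR => ?_)
      · obtain ⟨hUAB, hvU⟩ := mem_filter.1 hU
        rw [not_not] at hvU
        obtain ⟨hUA, hUB⟩ := mem_filter.1 hUAB
        refine mem_filter.2 ⟨(mem_tr_insert_iff hv).2 ⟨notMem_erase v U, by rw [insert_erase hvU]; exact hUA⟩, ?_⟩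
        refine mem_tr_erase_iff.2 ⟨by simp, ?_⟩
        rwa [← hss'' (U.erase v) (notMem_erase v U), insert_erase hvU]
      · have h1 : v ∈ U := not_not.1 (mem_filter.1 hU).2
        have h2 : v ∈ U' := not_not.1 (mem_filter.1 hU').2
        rw [← insert_erase h1, h, insert_erase h2]
      · obtain ⟨hRA, hRB⟩ := mem_filter.1 hR
        obtain ⟨hvR, hRA'⟩ := (mem_tr_insert_iff hv).1 hRA
        obtain ⟨_, hRB'⟩ := mem_tr_erase_iff.1 hRB
        refine ⟨insert v R, mem_filter.2 ⟨mem_filter.2 ⟨hRA', ?_⟩, not_not.2 (mem_insert_self v R)⟩, erase_insert hvR⟩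
        rwa [hss'' R hvR]
  -- (3) bookkeeping with A0 ⊆ A1, B0 ⊆ B1
  have hA01 : tr 𝒳 D (s.erase v) ⊆ tr 𝒳 (insert v D) (s.erase v) := tr_erase_subset_tr_insert h𝒳
  have hB01 : tr 𝒵 D (s.erase v) ⊆ tr 𝒵 (insert v D) (s.erase v) := tr_erase_subset_tr_insert h𝒵
  have split3 : ∀ (A' : Finset (Finset α)), #(A'.filter fun R => s.erase v \ R ∈ tr 𝒵 (insert v D) (s.erase v)) =
      #(A'.filter fun R => s.erase v \ R ∈ tr 𝒵 D (s.erase v)) +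
      #(A'.filter fun R => s.erase v \ R ∈ tr 𝒵 (insert v D) (s.erase v) ∧ s.erase v \ R ∉ tr 𝒵 D (s.erase v)) := by
    intro A'
    rw [← card_union_of_disjoint (disjoint_filter.2 fun R _ h1 h2 => h2.2 h1)]
    congr 1; ext R; simp only [mem_filter, mem_union]
    constructor
    · rintro ⟨hR, hB⟩
      by_cases h0 : s.erase v \ R ∈ tr 𝒵 D (s.erase v)
      · exact Or.inl ⟨hR, h0⟩
      · exact Or.inr ⟨hR, hB, h0⟩
    · rintro (⟨hR, h0⟩ | ⟨hR, hB, _⟩)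
      · exact ⟨hR, hB01 h0⟩
      · exact ⟨hR, hB⟩
  have c5 : #((tr 𝒳 (insert v D) (s.erase v)).filter fun R =>
        s.erase v \ R ∈ tr 𝒵 (insert v D) (s.erase v) ∧ s.erase v \ R ∉ tr 𝒵 D (s.erase v)) =
      #((tr 𝒳 D (s.erase v)).filter fun R =>
        s.erase v \ R ∈ tr 𝒵 (insert v D) (s.erase v) ∧ s.erase v \ R ∉ tr 𝒵 D (s.erase v)) +
      #((tr 𝒳 (insert v D) (s.erase v) \ tr 𝒳 D (s.erase v)).filter fun R =>
        s.erase v \ R ∈ tr 𝒵 (insert v D) (s.erase v) ∧ s.erase v \ R ∉ tr 𝒵 D (s.erase v)) := by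
    rw [← card_union_of_disjoint (disjoint_filter_filter
      (disjoint_sdiff (s := tr 𝒳 D (s.erase v)) (t := tr 𝒳 (insert v D) (s.erase v))))]
    congr 1; ext R; simp only [mem_filter, mem_union, mem_sdiff]
    constructor
    · rintro ⟨hR1, hQ⟩
      by_cases h0 : R ∈ tr 𝒳 D (s.erase v)
      · exact Or.inl ⟨h0, hQ⟩
      · exact Or.inr ⟨⟨hR1, h0⟩, hQ⟩
    · rintro (⟨h0, hQ⟩ | ⟨⟨hR1, _⟩, hQ⟩)
      · exact ⟨hA01 h0, hQ⟩
      · exact ⟨hR1, hQ⟩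
  have c3 := split3 (tr 𝒳 (insert v D) (s.erase v))
  have c4 := split3 (tr 𝒳 D (s.erase v))
  unfold kap
  rw [c1, c2, c3, c4, c5]; push_cast; ring

/-- `κ ≥ 0` for two up-sets on every sub-cube (Kleitman twice; here from the vertex recursion by induction on the free set). [folklore] -/
theorem kap_nonneg (h𝒳 : IsUpperSet (𝒳 : Set (Finset α))) (h𝒵 : IsUpperSet (𝒵 : Set (Finset α))) :
    ∀ (s D : Finset α), Disjoint D s → 0 ≤ kap 𝒳 𝒵 D s := by
  intro s
  induction s using Finset.induction_on with
  | empty =>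
    intro D _
    unfold kap
    -- on the empty free set both counts equal [D ∈ 𝒳 ∧ D ∈ 𝒵]
    have key : ((tr 𝒳 D ∅).filter fun U => (∅ : Finset α) \ U ∈ tr 𝒵 D ∅) = tr 𝒳 D ∅ ∩ tr 𝒵 D ∅ := by
      ext U
      simp only [mem_filter, mem_inter, empty_sdiff]
      constructor
      · rintro ⟨hUX, hZ⟩
        have hU : U = ∅ := subset_empty.1 (subset_of_mem_tr hUX)
        subst hU; exact ⟨hUX, hZ⟩
      · rintro ⟨hUX, hUZ⟩
        have hU : U = ∅ := subset_empty.1 (subset_of_mem_tr hUX)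
        subst hU; exact ⟨hUX, hUZ⟩
    rw [key, sub_self]
  | insert v s hvs ih =>
    intro D hD
    have hv : v ∈ insert v s := mem_insert_self v s
    have hvD : v ∉ D := fun h => (disjoint_left.1 hD h) hv
    rw [kap_rec h𝒳 h𝒵 hv hvD, erase_insert hvs]
    have hD' : Disjoint D s := Disjoint.mono_right (subset_insert v s) hD
    have hD'' : Disjoint (insert v D) s := by
      rw [disjoint_insert_left]; exact ⟨hvs, hD'⟩
    have h1 := ih D hD'
    have h2 := ih (insert v D) hD''
    positivity

/-- Deleting a free point does not increase `κ` (for up-sets): `κ(D, s−v) ≤ κ(D, s)`. [this work] -/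
theorem kap_erase_le (h𝒳 : IsUpperSet (𝒳 : Set (Finset α))) (h𝒵 : IsUpperSet (𝒵 : Set (Finset α))) (hDs : Disjoint D s)
    (hv : v ∈ s) : kap 𝒳 𝒵 D (s.erase v) ≤ kap 𝒳 𝒵 D s := by
  have hvD : v ∉ D := fun h => (disjoint_left.1 hDs h) hv
  rw [kap_rec h𝒳 h𝒵 hv hvD]
  have hD'' : Disjoint (insert v D) (s.erase v) := by
    rw [disjoint_insert_left]; exact ⟨notMem_erase v s, Disjoint.mono_right (erase_subset v s) hDs⟩
  have h2 := kap_nonneg h𝒳 h𝒵 (s.erase v) (insert v D) hD''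
  have h3 : (0 : ℤ) ≤ #((tr 𝒳 (insert v D) (s.erase v) \ tr 𝒳 D (s.erase v)).filter fun R =>
        (s.erase v) \ R ∈ tr 𝒵 (insert v D) (s.erase v) ∧ (s.erase v) \ R ∉ tr 𝒵 D (s.erase v)) := Nat.cast_nonneg _
  linarith

end Rec

end Summit.CriticalPhenomena.PercolationContinuityZ3.Theorems.SahiCTCForms
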